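import Literature.Analysis.SpecialFunctions.HypergeometricODE
import Literature.Analysis.SpecialFunctions.HypergeometricEulerIntegral
import Mathlib.Analysis.Analytic.Binomial
import HarnessLib

/-!
# Euler's integral equals Gauss's series on the disc (DLMF 15.6.1); the hypergeometric equation
# for Euler's integral on the half-plane `Re z < 1`; the throat form on the half-line

Continuation of `HypergeometricEulerIntegral.lean` (definition `eulerHypergeometric a b c z =
Γ(c)/(Γ(b)Γ(c−b)) ∫₀¹ t^{b−1}(1−t)^{c−b−1}(1−zt)^{−a} dt`, its convergence and holomorphy on
`H = {Re z < 1}` for `Re c > Re b > 0`) and of `HypergeometricODE.lean` (the series `₂F₁ a b c`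
on the unit disc: DLMF 15.5.1, 15.10.1). Here:

* `hasSum_one_sub_cpow_neg` — the binomial series `(1 − w)^{−a} = Σ (a)ₙ wⁿ/n!`, `‖w‖ < 1`
  (Mathlib's `Complex.one_add_cpow_hasFPowerSeriesOnBall_zero` in Pochhammer form);
* `Gamma_add_nat_eq` (`Γ(s+n) = (s)ₙΓ(s)`), `integral_pow_mul_betaIntegrand` (the Beta moments
  `∫₀¹ tⁿ t^{b−1}(1−t)^{c−b−1} = (b)ₙΓ(b)Γ(c−b)/((c)ₙΓ(c))`, Mathlib's
  `Complex.Gamma_mul_Gamma_eq_betaIntegral`);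
* `eulerIntegral_eq`, `eulerHypergeometric_eq_ordinaryHypergeometric` — **DLMF 15.6.1**:
  `E(a,b;c;z) = ₂F₁(a,b;c;z)` on `‖z‖ < 1` (termwise integration by dominated convergence — the
  complex-parameter version of the tree's real `LegendreP.euler_integral_ordinaryHypergeometric`);
  `eulerHypergeometric_zero` (`E(0) = 1`);
* `eulerHypergeometric_ode` — **the hypergeometric equation on all of `H`**: the residual
  `z(1−z)E″ + (c − (a+b+1)z)E′ − abE` (with `E′ = (ab/c)E(a+1,b+1;c+1;·)`,
  `E″ = (ab/c)((a+1)(b+1)/(c+1))E(a+2,b+2;c+2;·)`, `hasDerivAt_eulerHypergeometric`) is analytic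
  on the convex set `H` and vanishes on the disc by 15.6.1 + `ordinaryHypergeometric_ode`, hence
  everywhere (identity theorem); `eulerHypergeometric_ode_hasDerivAt` packages the two
  `HasDerivAt` facts with the equation;
* `eulerHypergeometric_throat_ode` — the real-variable corollary in `z = −x` for ALL `x > −1`:
  `g x := E(a,b;c;−x)` satisfies `x(1+x)g″ + (c + (a+b+1)x)g′ + ab·g = 0` with explicit
  `g′, g″` and `HasDerivAt` — the hypothesis shape of
  `Kerr.TeukolskyPress.throatSolution_of_hypergeometric` (near-extremal Kerr cap model, where
  `Re b = ½`, `Re c = 1`), and `eulerHypergeometric_neg_ofReal_eq`: `g = ₂F₁(a,b;c;−x)` on `|x| < 1`.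

Not here: the two-term behaviour of `E(a,b;c;−x)` as `x → +∞` (DLMF 15.8.2).

References: NIST DLMF (15.4.6), (15.6.1), (15.10.1), (5.12.1) [DLMF]; Andrews–Askey–Roy,
*Special Functions* (1999), Thm 2.2.1, (2.3.5) [AndrewsAskeyRoy1999].
-/

noncomputable section

open Filter Metric MeasureTheory Set
open scoped Topology Nat

namespace Literature.Analysis.SpecialFunctions.Hypergeometric

/-! ### The binomial series in Pochhammer form -/

/-- **Binomial series**, Pochhammer form: `(1 − w)^{−a} = Σₙ (a)ₙ/n! · wⁿ` for complex `a` and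
`‖w‖ < 1` (principal power; from Mathlib's `Complex.one_add_cpow_hasFPowerSeriesOnBall_zero`).
[cite: DLMF, 15.4.6] -/
theorem hasSum_one_sub_cpow_neg (a : ℂ) {w : ℂ} (hw : ‖w‖ < 1) :
    HasSum (fun n : ℕ => ((n ! : ℕ) : ℂ)⁻¹ * (ascPochhammer ℂ n).eval a * w ^ n)
      ((1 - w) ^ (-a)) := by
  have hps := Complex.one_add_cpow_hasFPowerSeriesOnBall_zero (a := -a)
  have h1 : ∀ k : ℕ, (k : ℂ) ≠ -1 := fun k h => by
    have := congrArg Complex.re h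
    simp at this
    linarith
  rw [binomialSeries_eq_ordinaryHypergeometricSeries (𝔸 := ℂ) (b := (1 : ℂ)) h1] at hps
  have hmem : -w ∈ Metric.eball (0 : ℂ) 1 := by
    rw [Metric.mem_eball, edist_zero_right, enorm_eq_nnnorm]
    have : ‖-w‖₊ < 1 := by
      rw [← NNReal.coe_lt_coe, coe_nnnorm, norm_neg]; exact_mod_cast hw
    exact_mod_cast this
  have h := hps.hasSum hmem
  simp only [FormalMultilinearSeries.compContinuousLinearMap_apply, zero_add, neg_neg] at h
  have e : (fun n : ℕ => (ordinaryHypergeometricSeries ℂ a 1 1 n)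
      (⇑(-ContinuousLinearMap.id ℂ ℂ) ∘ fun _ : Fin n => -w)) =
      fun n : ℕ => ((n ! : ℕ) : ℂ)⁻¹ * (ascPochhammer ℂ n).eval a * w ^ n := by
    funext n
    have hc : (⇑(-ContinuousLinearMap.id ℂ ℂ) ∘ fun _ : Fin n => -w) = fun _ => w := by
      funext i; simp
    rw [hc, ordinaryHypergeometricSeries_apply_eq, smul_eq_mul, ascPochhammer_eval_one]
    have hn : ((n ! : ℕ) : ℂ) ≠ 0 := by exact_mod_cast Nat.factorial_ne_zero n
    field_simp
  rw [e, ← sub_eq_add_neg] at h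
  exact h

/-! ### Gamma, Pochhammer and the Beta moments -/

/-- `Γ(s + n) = (s)ₙ Γ(s)` for `Re s > 0` (complex). [cite: DLMF, 5.2.5] -/
theorem Gamma_add_nat_eq (s : ℂ) (hs : 0 < s.re) (n : ℕ) :
    Complex.Gamma (s + n) = (ascPochhammer ℂ n).eval s * Complex.Gamma s := by
  induction n with
  | zero => simp
  | succ n ih =>
    have hsn : s + n ≠ 0 := fun h => by
      have := congrArg Complex.re h
      simp at this
      linarith
    rw [ascPochhammer_succ_eval, Nat.cast_succ, ← add_assoc, Complex.Gamma_add_one _ hsn, ih]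
    ring

/-- `(c)ₙ Γ(c) = Γ(c + n) ≠ 0` for `Re c > 0` (the denominators of the Beta moments).
[cite: DLMF, 5.2.5] -/
theorem ascPochhammer_mul_Gamma_ne_zero {c : ℂ} (hc : 0 < c.re) (n : ℕ) :
    (ascPochhammer ℂ n).eval c * Complex.Gamma c ≠ 0 := by
  rw [← Gamma_add_nat_eq c hc n]
  exact Complex.Gamma_ne_zero_of_re_pos (by simp; linarith)

/-- **The Beta moments**: for `Re c > Re b > 0`,
`∫₀¹ tⁿ · t^{b−1}(1−t)^{c−b−1} dt = B(b+n, c−b) = (b)ₙ Γ(b)Γ(c−b) / ((c)ₙ Γ(c))`.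
[cite: DLMF, 5.12.1] -/
theorem integral_pow_mul_betaIntegrand {b c : ℂ} (hb : 0 < b.re) (hbc : b.re < c.re) (n : ℕ) :
    ∫ t in (0 : ℝ)..1, (t : ℂ) ^ n * ((t : ℂ) ^ (b - 1) * (1 - (t : ℂ)) ^ (c - b - 1)) =
      (ascPochhammer ℂ n).eval b * Complex.Gamma b * Complex.Gamma (c - b) /
        ((ascPochhammer ℂ n).eval c * Complex.Gamma c) := by
  have hc : 0 < c.re := hb.trans hbc
  have hcb : 0 < (c - b).re := by rw [Complex.sub_re]; linarith
  have hbn : 0 < (b + n).re := by simp; linarith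
  have hB := Complex.Gamma_mul_Gamma_eq_betaIntegral hbn hcb
  rw [show b + n + (c - b) = c + n by ring, Gamma_add_nat_eq b hb, Gamma_add_nat_eq c hc] at hB
  have hI : ∫ t in (0 : ℝ)..1, (t : ℂ) ^ n * ((t : ℂ) ^ (b - 1) * (1 - (t : ℂ)) ^ (c - b - 1)) =
      Complex.betaIntegral (b + n) (c - b) := by
    rw [Complex.betaIntegral]
    refine intervalIntegral.integral_congr_ae (ae_of_all _ fun t ht => ?_)
    rw [uIoc_of_le zero_le_one] at ht
    have ht0 : (t : ℂ) ≠ 0 := Complex.ofReal_ne_zero.2 ht.1.ne'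
    rw [show b + n - 1 = (n : ℂ) + (b - 1) by ring, Complex.cpow_add _ _ ht0, Complex.cpow_natCast]
    ring
  rw [hI, eq_div_iff (ascPochhammer_mul_Gamma_ne_zero hc n)]
  linear_combination (-1 : ℂ) * hB

/-! ### DLMF 15.6.1: Euler's integral equals the series on the unit disc -/

/-- **Euler's integral representation, DLMF 15.6.1** (without the prefactor): for
`Re c > Re b > 0` and `‖z‖ < 1`,
`∫₀¹ t^{b−1}(1−t)^{c−b−1}(1−zt)^{−a} dt = Γ(b)Γ(c−b)/Γ(c) · ₂F₁(a,b;c;z)` — termwise integration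
of the binomial series against the Beta moments (dominated convergence, majorant
`Σ |(a)ₙ/n!| ‖z‖ⁿ · |t^{b−1}(1−t)^{c−b−1}|`). [cite: DLMF, 15.6.1] -/
theorem eulerIntegral_eq (a : ℂ) {b c : ℂ} (hb : 0 < b.re) (hbc : b.re < c.re) {z : ℂ}
    (hz : ‖z‖ < 1) :
    eulerIntegral a b c z =
      Complex.Gamma b * Complex.Gamma (c - b) / Complex.Gamma c * ₂F₁ a b c z := by
  have hc : 0 < c.re := hb.trans hbc
  have hcb : 0 < (c - b).re := by rw [Complex.sub_re]; linarith
  set K : ℕ → ℂ := fun n => ((n ! : ℕ) : ℂ)⁻¹ * (ascPochhammer ℂ n).eval a with hK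
  set w : ℝ → ℂ := fun t => (t : ℂ) ^ (b - 1) * (1 - (t : ℂ)) ^ (c - b - 1) with hw
  set F : ℕ → ℝ → ℂ := fun n t => K n * z ^ n * ((t : ℂ) ^ n * w t) with hF
  set bound : ℕ → ℝ → ℝ := fun n t => ‖K n‖ * ‖z‖ ^ n * ‖w t‖ with hbound
  have hw_int : IntervalIntegrable w volume 0 1 := Complex.betaIntegral_convergent hb hcb
  -- `Σ ‖Kₙ‖ ‖z‖ⁿ` converges: `Kₙ` are the coefficients of `₂F₁(a,1;1;·)`
  have hKz : Summable fun n : ℕ => ‖K n‖ * ‖z‖ ^ n := by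
    have h := summable_norm_coeff_mul_pow a 1 1 (norm_nonneg z) hz
    refine h.congr fun n => ?_
    congr 1
    simp only [hK, ordinaryHypergeometricCoefficient, ascPochhammer_eval_one]
    have hn : ((n ! : ℕ) : ℂ) ≠ 0 := by exact_mod_cast Nat.factorial_ne_zero n
    rw [mul_assoc (((n ! : ℕ) : ℂ)⁻¹ * Polynomial.eval a (ascPochhammer ℂ n)),
      mul_inv_cancel₀ hn, mul_one]
  have hF_meas : ∀ n, AEStronglyMeasurable (F n) (volume.restrict (uIoc (0 : ℝ) 1)) := by
    intro n
    have h : IntervalIntegrable (fun t : ℝ => (t : ℂ) ^ n * w t) volume 0 1 :=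
      hw_int.continuousOn_mul (Continuous.continuousOn (by fun_prop))
    exact (h.const_mul (K n * z ^ n)).def'.aestronglyMeasurable
  have h_bound : ∀ n, ∀ᵐ t ∂volume, t ∈ uIoc (0 : ℝ) 1 → ‖F n t‖ ≤ bound n t := by
    intro n
    refine ae_of_all _ fun t ht => ?_
    rw [uIoc_of_le zero_le_one] at ht
    have htn : ‖(t : ℂ) ^ n‖ ≤ 1 := by
      rw [norm_pow, Complex.norm_real, Real.norm_eq_abs, abs_of_pos ht.1]
      exact pow_le_one₀ ht.1.le ht.2
    have e : ‖F n t‖ = ‖K n‖ * ‖z‖ ^ n * (‖(t : ℂ) ^ n‖ * ‖w t‖) := by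
      simp only [hF]
      rw [norm_mul (K n * z ^ n), norm_mul (K n), norm_mul ((t : ℂ) ^ n), norm_pow z]
    rw [e]
    calc ‖K n‖ * ‖z‖ ^ n * (‖(t : ℂ) ^ n‖ * ‖w t‖) ≤ ‖K n‖ * ‖z‖ ^ n * (1 * ‖w t‖) := by gcongr
      _ = bound n t := by rw [one_mul]
  have bound_summable : ∀ᵐ t ∂volume, t ∈ uIoc (0 : ℝ) 1 → Summable fun n => bound n t :=
    ae_of_all _ fun t _ => by simpa only [hbound] using hKz.mul_right (‖w t‖)
  have bound_integrable : IntervalIntegrable (fun t => ∑' n, bound n t) volume 0 1 := by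
    have e : (fun t => ∑' n, bound n t) = fun t => (∑' n : ℕ, ‖K n‖ * ‖z‖ ^ n) * ‖w t‖ := by
      funext t; simp only [hbound]; exact tsum_mul_right
    rw [e]
    exact hw_int.norm.const_mul _
  have h_lim : ∀ᵐ t ∂volume, t ∈ uIoc (0 : ℝ) 1 →
      HasSum (fun n => F n t) (w t * (1 - z * (t : ℂ)) ^ (-a)) := by
    refine ae_of_all _ fun t ht => ?_
    rw [uIoc_of_le zero_le_one] at ht
    have hzt : ‖z * (t : ℂ)‖ < 1 := by
      rw [norm_mul, Complex.norm_real, Real.norm_eq_abs, abs_of_pos ht.1]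
      calc ‖z‖ * t ≤ ‖z‖ * 1 := by gcongr; exact ht.2
        _ < 1 := by rw [mul_one]; exact hz
    have h := (hasSum_one_sub_cpow_neg a hzt).mul_left (w t)
    have e : (fun n => F n t) = fun i : ℕ =>
        w t * (((i ! : ℕ) : ℂ)⁻¹ * (ascPochhammer ℂ i).eval a * (z * (t : ℂ)) ^ i) := by
      funext n; simp only [hF, hK, mul_pow]; ring
    rw [e]; exact h
  have hmain := intervalIntegral.hasSum_integral_of_dominated_convergence bound hF_meas h_bound
    bound_summable bound_integrable h_lim
  -- each term integrates to a Beta moment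
  have hΓb := Complex.Gamma_ne_zero_of_re_pos hb
  have hΓc := Complex.Gamma_ne_zero_of_re_pos hc
  have hΓcb := Complex.Gamma_ne_zero_of_re_pos hcb
  have hFn : ∀ n : ℕ, ∫ t in (0 : ℝ)..1, F n t =
      Complex.Gamma b * Complex.Gamma (c - b) / Complex.Gamma c *
        (ordinaryHypergeometricCoefficient a b c n * z ^ n) := by
    intro n
    have hI := integral_pow_mul_betaIntegrand hb hbc n
    have hcn : (ascPochhammer ℂ n).eval c ≠ 0 :=
      (mul_ne_zero_iff.1 (ascPochhammer_mul_Gamma_ne_zero hc n)).1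
    have hn : ((n ! : ℕ) : ℂ) ≠ 0 := by exact_mod_cast Nat.factorial_ne_zero n
    calc ∫ t in (0 : ℝ)..1, F n t = K n * z ^ n * ∫ t in (0 : ℝ)..1, (t : ℂ) ^ n * w t := by
          simp only [hF]; exact intervalIntegral.integral_const_mul _ _
      _ = _ := by
          simp only [hw]
          rw [hI]
          simp only [hK, ordinaryHypergeometricCoefficient]
          field_simp
  have e : (fun n => ∫ t in (0 : ℝ)..1, F n t) = fun n : ℕ =>
      Complex.Gamma b * Complex.Gamma (c - b) / Complex.Gamma c *
        (ordinaryHypergeometricCoefficient a b c n * z ^ n) := funext hFn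
  rw [e] at hmain
  have h2 := (hasSum_coeff_mul_pow (a := a) (b := b) (c := c) hz).mul_left
    (Complex.Gamma b * Complex.Gamma (c - b) / Complex.Gamma c)
  have := hmain.unique h2
  rw [eulerIntegral]
  simpa only [eulerIntegrand, hw] using this

/-- **DLMF 15.6.1**: for `Re c > Re b > 0`, Euler's hypergeometric function agrees with Gauss's
series on the unit disc: `E(a,b;c;z) = ₂F₁(a,b;c;z)` for `‖z‖ < 1`. [cite: DLMF, 15.6.1] -/
theorem eulerHypergeometric_eq_ordinaryHypergeometric (a : ℂ) {b c : ℂ} (hb : 0 < b.re)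
    (hbc : b.re < c.re) {z : ℂ} (hz : ‖z‖ < 1) :
    eulerHypergeometric a b c z = ₂F₁ a b c z := by
  have hc : 0 < c.re := hb.trans hbc
  have hΓb := Complex.Gamma_ne_zero_of_re_pos hb
  have hΓc := Complex.Gamma_ne_zero_of_re_pos hc
  have hΓcb : Complex.Gamma (c - b) ≠ 0 :=
    Complex.Gamma_ne_zero_of_re_pos (by rw [Complex.sub_re]; linarith)
  rw [eulerHypergeometric, eulerIntegral_eq a hb hbc hz]
  field_simp

/-- Normalisation: `E(a,b;c;0) = 1` for `Re c > Re b > 0` (`= ₂F₁(a,b;c;0)`; equivalently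
`B(b, c−b) = Γ(b)Γ(c−b)/Γ(c)`). [cite: DLMF, 15.6.1] -/
theorem eulerHypergeometric_zero (a : ℂ) {b c : ℂ} (hb : 0 < b.re) (hbc : b.re < c.re) :
    eulerHypergeometric a b c 0 = 1 := by
  rw [eulerHypergeometric_eq_ordinaryHypergeometric a hb hbc (by simp), ordinaryHypergeometric_zero]

/-! ### The hypergeometric equation on the half-plane `Re z < 1` -/

/-- Shifted parameters keep `Re c > Re b > 0`. [folklore] -/
theorem re_add_nat_pos {b : ℂ} (hb : 0 < b.re) (k : ℕ) : 0 < (b + k).re := by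
  simp; positivity

/-- Shifted parameters keep `Re b < Re c`. [folklore] -/
theorem re_add_nat_lt {b c : ℂ} (hbc : b.re < c.re) (k : ℕ) : (b + k).re < (c + k).re := by
  simpa using hbc

/-- **The hypergeometric equation for Euler's integral on the half-plane** (DLMF 15.10.1 with
15.6.1): for `Re c > Re b > 0` and every `z` with `Re z < 1`, `E = eulerHypergeometric a b c`
satisfies `z(1−z)E″ + (c − (a+b+1)z)E′ − ab E = 0` with `E′ = (ab/c)E(a+1,b+1;c+1;·)`,
`E″ = (ab/c)((a+1)(b+1)/(c+1))E(a+2,b+2;c+2;·)`. Proof: the residual is analytic on the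
(convex) half-plane and vanishes on the unit disc, where `E = ₂F₁` termwise
(`ordinaryHypergeometric_ode`); identity theorem. [cite: DLMF, 15.10.1] -/
theorem eulerHypergeometric_ode (a : ℂ) {b c : ℂ} (hb : 0 < b.re) (hbc : b.re < c.re) {z : ℂ}
    (hz : z.re < 1) :
    z * (1 - z) * (a * b / c * ((a + 1) * (b + 1) / (c + 1) *
        eulerHypergeometric (a + 2) (b + 2) (c + 2) z)) +
      (c - (a + b + 1) * z) * (a * b / c * eulerHypergeometric (a + 1) (b + 1) (c + 1) z) -
      a * b * eulerHypergeometric a b c z = 0 := by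
  have hb1 : 0 < (b + 1).re := by simpa using re_add_nat_pos hb 1
  have hbc1 : (b + 1).re < (c + 1).re := by simpa using re_add_nat_lt hbc 1
  have hb2 : 0 < (b + 2).re := by simpa using re_add_nat_pos hb 2
  have hbc2 : (b + 2).re < (c + 2).re := by simpa using re_add_nat_lt hbc 2
  set R : ℂ → ℂ := fun w => w * (1 - w) * (a * b / c * ((a + 1) * (b + 1) / (c + 1) *
        eulerHypergeometric (a + 2) (b + 2) (c + 2) w)) +
      (c - (a + b + 1) * w) * (a * b / c * eulerHypergeometric (a + 1) (b + 1) (c + 1) w) -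
      a * b * eulerHypergeometric a b c w with hR
  -- `R` is analytic on the half-plane
  have key : ∀ E₀ E₁ E₂ : ℂ → ℂ, DifferentiableOn ℂ E₀ {w : ℂ | w.re < 1} →
      DifferentiableOn ℂ E₁ {w : ℂ | w.re < 1} → DifferentiableOn ℂ E₂ {w : ℂ | w.re < 1} →
      DifferentiableOn ℂ (fun w => w * (1 - w) * (a * b / c * ((a + 1) * (b + 1) / (c + 1) * E₂ w)) +
        (c - (a + b + 1) * w) * (a * b / c * E₁ w) - a * b * E₀ w) {w : ℂ | w.re < 1} := by
    intro E₀ E₁ E₂ h₀ h₁ h₂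
    fun_prop
  have hRan : AnalyticOnNhd ℂ R {w : ℂ | w.re < 1} :=
    (key _ _ _ (differentiableOn_eulerHypergeometric a hb hbc)
      (differentiableOn_eulerHypergeometric (a + 1) hb1 hbc1)
      (differentiableOn_eulerHypergeometric (a + 2) hb2 hbc2)).analyticOnNhd isOpen_re_lt_one
  -- `R` vanishes on the unit disc, where `E = ₂F₁`
  have hzero : ∀ w ∈ ball (0 : ℂ) 1, R w = 0 := by
    intro w hw
    have hw' : ‖w‖ < 1 := mem_ball_zero_iff.1 hw
    simp only [hR]
    rw [eulerHypergeometric_eq_ordinaryHypergeometric (a + 2) hb2 hbc2 hw',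
      eulerHypergeometric_eq_ordinaryHypergeometric (a + 1) hb1 hbc1 hw',
      eulerHypergeometric_eq_ordinaryHypergeometric a hb hbc hw']
    -- `Re c > 0` excludes the poles `c ∈ −ℕ` of the hypergeometric coefficients
    have hcn : ∀ n : ℕ, c ≠ -n := fun n h => by
      have h' := congrArg Complex.re h
      simp at h'
      linarith [n.cast_nonneg (α := ℝ), hb.trans hbc]
    exact ordinaryHypergeometric_ode hcn hw'
  have hev : R =ᶠ[𝓝 (0 : ℂ)] 0 :=
    Filter.eventually_of_mem (ball_mem_nhds (0 : ℂ) one_pos) fun w hw => hzero w hw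
  have h0 : (0 : ℂ) ∈ {w : ℂ | w.re < 1} := by
    show (0 : ℂ).re < 1
    simp
  have hRz := hRan.eqOn_zero_of_preconnected_of_eventuallyEq_zero convex_re_lt_one.isPreconnected
    h0 hev hz
  simpa only [hR, Pi.zero_apply] using hRz

/-- **DLMF 15.10.1 for Euler's integral in pointwise `HasDerivAt` form** on the half-plane
`Re z < 1` (`Re c > Re b > 0`): with `E′ z = (ab/c) E(a+1,b+1;c+1;z)` and
`E″ z = (ab/c)((a+1)(b+1)/(c+1)) E(a+2,b+2;c+2;z)`, `E = eulerHypergeometric a b c` has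
derivative `E′ z`, `E′` has derivative `E″ z`, and `z(1−z)E″ z + (c − (a+b+1)z)E′ z − ab E z = 0`.
[cite: DLMF, 15.10.1] -/
theorem eulerHypergeometric_ode_hasDerivAt (a : ℂ) {b c : ℂ} (hb : 0 < b.re) (hbc : b.re < c.re)
    {z : ℂ} (hz : z.re < 1) :
    HasDerivAt (eulerHypergeometric a b c)
      (a * b / c * eulerHypergeometric (a + 1) (b + 1) (c + 1) z) z ∧
    HasDerivAt (fun w : ℂ => a * b / c * eulerHypergeometric (a + 1) (b + 1) (c + 1) w)
      (a * b / c * ((a + 1) * (b + 1) / (c + 1) *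
        eulerHypergeometric (a + 2) (b + 2) (c + 2) z)) z ∧
    z * (1 - z) * (a * b / c * ((a + 1) * (b + 1) / (c + 1) *
        eulerHypergeometric (a + 2) (b + 2) (c + 2) z)) +
      (c - (a + b + 1) * z) * (a * b / c * eulerHypergeometric (a + 1) (b + 1) (c + 1) z) -
      a * b * eulerHypergeometric a b c z = 0 := by
  have hb1 : 0 < (b + 1).re := by simpa using re_add_nat_pos hb 1
  have hbc1 : (b + 1).re < (c + 1).re := by simpa using re_add_nat_lt hbc 1
  refine ⟨hasDerivAt_eulerHypergeometric a hb hbc hz, ?_, eulerHypergeometric_ode a hb hbc hz⟩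
  have h := (hasDerivAt_eulerHypergeometric (a + 1) hb1 hbc1 hz).const_mul (a * b / c)
  rw [show a + 1 + 1 = a + 2 by ring, show b + 1 + 1 = b + 2 by ring,
    show c + 1 + 1 = c + 2 by ring] at h
  exact h

/-- **The throat form of the hypergeometric equation on the whole half-line** (the cap model
of near-extremal Kerr, variable `z = −x`): for `Re c > Re b > 0` and real `x > −1`, the function
`g x := E(a,b;c;−x)` (Euler's hypergeometric function) has `g′(x) = −E′(−x)`,
`g″(x) = E″(−x)` and satisfies `x(1+x) g″ + (c + (a+b+1)x) g′ + ab g = 0` — the hypothesis shape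
of `Kerr.TeukolskyPress.throatSolution_of_hypergeometric`, now for ALL `x > 0` (beyond the unit
disc), and `g = ₂F₁(a,b;c;−x)` for `0 ≤ x < 1`. [cite: DLMF, 15.10.1] -/
theorem eulerHypergeometric_throat_ode (a : ℂ) {b c : ℂ} (hb : 0 < b.re) (hbc : b.re < c.re)
    {x : ℝ} (hx : -1 < x) :
    HasDerivAt (fun y : ℝ => eulerHypergeometric a b c (-(y : ℂ)))
      (-(a * b / c * eulerHypergeometric (a + 1) (b + 1) (c + 1) (-(x : ℂ)))) x ∧
    HasDerivAt (fun y : ℝ => -(a * b / c * eulerHypergeometric (a + 1) (b + 1) (c + 1) (-(y : ℂ))))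
      (a * b / c * ((a + 1) * (b + 1) / (c + 1) *
        eulerHypergeometric (a + 2) (b + 2) (c + 2) (-(x : ℂ)))) x ∧
    (x : ℂ) * (1 + x) * (a * b / c * ((a + 1) * (b + 1) / (c + 1) *
        eulerHypergeometric (a + 2) (b + 2) (c + 2) (-(x : ℂ)))) +
      (c + (a + b + 1) * x) *
        (-(a * b / c * eulerHypergeometric (a + 1) (b + 1) (c + 1) (-(x : ℂ)))) +
      a * b * eulerHypergeometric a b c (-(x : ℂ)) = 0 := by
  have hz : (-(x : ℂ)).re < 1 := by simp; linarith
  obtain ⟨h1, h2, h3⟩ := eulerHypergeometric_ode_hasDerivAt a hb hbc hz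
  have hneg : HasDerivAt (fun y : ℝ => -(y : ℂ)) (-1) x := (hasDerivAt_neg (x : ℂ)).comp_ofReal
  refine ⟨?_, ?_, ?_⟩
  · refine (h1.comp x hneg).congr_deriv ?_
    ring
  · refine ((h2.comp x hneg).neg).congr_deriv ?_
    ring
  · linear_combination (-1 : ℂ) * h3

/-- On `0 ≤ x < 1` the throat function of `eulerHypergeometric_throat_ode` IS Gauss's series:
`E(a,b;c;−x) = ₂F₁(a,b;c;−x)` (`Re c > Re b > 0`, `|x| < 1`). [cite: DLMF, 15.6.1] -/
theorem eulerHypergeometric_neg_ofReal_eq (a : ℂ) {b c : ℂ} (hb : 0 < b.re) (hbc : b.re < c.re)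
    {x : ℝ} (hx : |x| < 1) :
    eulerHypergeometric a b c (-(x : ℂ)) = ₂F₁ a b c (-(x : ℂ)) :=
  eulerHypergeometric_eq_ordinaryHypergeometric a hb hbc
    (by rwa [norm_neg, Complex.norm_real, Real.norm_eq_abs])

end Literature.Analysis.SpecialFunctions.Hypergeometric

end
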